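import Mathlib.Analysis.SpecialFunctions.SmoothTransition
import Mathlib.MeasureTheory.Integral.IntervalIntegral.FundThmCalculus
import Mathlib.Analysis.Calculus.Deriv.MeanValue
import Mathlib.Analysis.Calculus.ContDiff.Basic
import Mathlib.Analysis.Calculus.Deriv.Inv
import HarnessLib

/-!
# The corner function of a plumbing: a symmetric, one-homogeneously smoothed minimum

Topic `Literature/Topology/FourManifolds`; analytic groundwork for cutting Kosinski's compact
plumbing `M(4m)` (A. Kosinski, *Differential Manifolds* (1993), VI.12) out of the open plumbing as
a regular sublevel set. Plumbing two disc bundles produces corners along `∂D × ∂D`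
(Kosinski VI.12 p. 120 and VI.6 "straightening the angle"); in a plumbing chart with squared
base and fibre radii `a = |x|²`, `b = |y|² ∈ [0, r²)` the two tubes are `{b ≤ ε}` and `{a ≤ ε}`
and the compact plumbing should be `{min(a, b) ≤ ε}` with the corner `{a = b = ε}` rounded. This
file provides the rounding function `Plumbing.cornerFn r² s (a, b)`:

* it is **symmetric** in `(a, b)` (so that it is compatible with the plumbing involution, which
  exchanges `a` and `b`), smooth on the half plane `{a + b < 2r²}`;
* it **equals `min(a, b)` off the wedge** `|a - b| < s (2r² - a - b)` around the diagonal — in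
  particular it equals `b` identically near the edge `{a = r²}` (for every `b < r²`), which is what
  lets it continue smoothly by the fibre radius `b` outside the plumbing chart;
* `min(a, b) - s(2r² - a - b)/2 ≤ cornerFn ≤ min(a, b)`;
* it is **monotone in each variable with total slope `≥ 1`**: along `τ ↦ (a, τ)` its derivative is
  `½ + ½ μ(t) + (s/2) g(t) ∈ [0, 1 + s]` and along the diagonal direction `τ ↦ (a + τ, b + τ)` it
  is `1 + s g(t) ≥ 1` (`t = (a - b)/(s(2r² - a - b))`), so that its positive levels contain no
  critical point and are graphs over `a - b`.

The construction: `μ(t) = 2λ((t + 1)/2) - 1` (`λ` = Mathlib's `Real.smoothTransition`) is a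
smooth odd monotone function, `= ±1` for `±t ≥ 1`; `A(t) = 1 + ∫₁ᵗ μ` is a smooth even convex
function with `A(t) = |t|` for `|t| ≥ 1` and `|t| ≤ A ≤ |t| + 1` (a smoothed absolute value), and
`g = A - t μ ≥ 0` vanishes for `|t| ≥ 1`; finally
`cornerFn r² s (a, b) = (a + b)/2 - σ/2 · A((a - b)/σ)`, `σ = s (2r² - a - b)` — one half of
`a + b` minus a one-homogeneously smoothed `|a - b|`. Everything is proved; no named facts.

## References

* A. Kosinski, *Differential Manifolds*, Academic Press 1993, VI.6 (straightening corners) and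
  VI.12 p. 120 (the corners of a plumbing). [Kosinski1993]
* M. W. Hirsch, *Differential Topology*, GTM 33 (1976), Ch. 2 §2 (smoothing by bump functions).
  [HirschDT1976]
-/

open scoped ContDiff Topology
open Set Filter MeasureTheory intervalIntegral

noncomputable section

namespace Literature.Topology.FourManifolds

namespace Plumbing

/-! ### §1 The odd transition `μ` -/

/-- `μ(t) = 2 λ((t + 1)/2) - 1`: a smooth odd monotone function, `-1` on `(-∞, -1]`, `1` on
`[1, ∞)`. [folklore] -/
def oddTrans (t : ℝ) : ℝ := 2 * Real.smoothTransition ((t + 1) / 2) - 1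

/-- `contDiff_oddTrans` (contDiff oddTrans). [folklore] -/
theorem contDiff_oddTrans {n : ℕ∞} : ContDiff ℝ n oddTrans := by
  unfold oddTrans
  exact (contDiff_const.mul (Real.smoothTransition.contDiff.comp
    ((contDiff_id.add contDiff_const).div_const 2))).sub contDiff_const

/-- `continuous_oddTrans` (continuous oddTrans). [folklore] -/
theorem continuous_oddTrans : Continuous oddTrans := (contDiff_oddTrans (n := 0)).continuous

/-- `monotone_oddTrans` (monotone oddTrans). [folklore] -/
theorem monotone_oddTrans : Monotone oddTrans := fun x y hxy => by
  unfold oddTrans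
  have := Real.smoothTransition.monotone (show (x + 1) / 2 ≤ (y + 1) / 2 by linarith)
  linarith

/-- `μ` is odd (the symmetry `λ(x) + λ(1 - x) = 1` of Mathlib's smooth transition; cf. the
tree's `smoothTransition_add_smoothTransition_one_sub` in `RailNeck.lean`, not imported here).
[folklore] -/
theorem oddTrans_neg (t : ℝ) : oddTrans (-t) = -oddTrans t := by
  have h : Real.smoothTransition ((t + 1) / 2) + Real.smoothTransition (1 - (t + 1) / 2) = 1 := by
    have hd := Real.smoothTransition.pos_denom ((t + 1) / 2)
    unfold Real.smoothTransition
    rw [sub_sub_cancel, add_comm (expNegInvGlue (1 - (t + 1) / 2)) (expNegInvGlue ((t + 1) / 2)),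
      ← add_div, div_self hd.ne']
  unfold oddTrans
  rw [show 1 - (t + 1) / 2 = (-t + 1) / 2 by ring] at h
  linarith

/-- `oddTrans_of_one_le` (oddTrans of one le). [folklore] -/
theorem oddTrans_of_one_le {t : ℝ} (ht : 1 ≤ t) : oddTrans t = 1 := by
  unfold oddTrans
  rw [Real.smoothTransition.one_of_one_le (by linarith)]; ring

/-- `oddTrans_of_le_neg_one` (oddTrans of le neg one). [folklore] -/
theorem oddTrans_of_le_neg_one {t : ℝ} (ht : t ≤ -1) : oddTrans t = -1 := by
  unfold oddTrans
  rw [Real.smoothTransition.zero_of_nonpos (by linarith)]; ring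

/-- `abs_oddTrans_le` (abs oddTrans le). [folklore] -/
theorem abs_oddTrans_le (t : ℝ) : |oddTrans t| ≤ 1 := by
  unfold oddTrans
  have h0 := Real.smoothTransition.nonneg ((t + 1) / 2)
  have h1 := Real.smoothTransition.le_one ((t + 1) / 2)
  rw [abs_le]; constructor <;> linarith

/-- `oddTrans_le_one` (oddTrans le one). [folklore] -/
theorem oddTrans_le_one (t : ℝ) : oddTrans t ≤ 1 := (abs_le.1 (abs_oddTrans_le t)).2

/-- `neg_one_le_oddTrans` (neg one le oddTrans). [folklore] -/
theorem neg_one_le_oddTrans (t : ℝ) : -1 ≤ oddTrans t := (abs_le.1 (abs_oddTrans_le t)).1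

/-- `oddTrans_zero` (oddTrans zero). [folklore] -/
theorem oddTrans_zero : oddTrans 0 = 0 := by
  have h := oddTrans_neg 0
  rw [neg_zero] at h
  linarith

/-- `oddTrans_nonneg` (oddTrans nonneg). [folklore] -/
theorem oddTrans_nonneg {t : ℝ} (ht : 0 ≤ t) : 0 ≤ oddTrans t := by
  rw [← oddTrans_zero]; exact monotone_oddTrans ht

/-- `deriv_oddTrans_nonneg` (deriv oddTrans nonneg). [folklore] -/
theorem deriv_oddTrans_nonneg (t : ℝ) : 0 ≤ deriv oddTrans t :=
  monotone_oddTrans.deriv_nonneg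

/-- `differentiable_oddTrans` (differentiable oddTrans). [folklore] -/
theorem differentiable_oddTrans : Differentiable ℝ oddTrans :=
  (contDiff_oddTrans (n := 1)).differentiable (by norm_num)

/-! ### §2 The smoothed absolute value `A` and the gap function `g = A - t μ` -/

/-- `A(t) = 1 + ∫₁ᵗ μ`: a smooth even convex function equal to `|t|` for `|t| ≥ 1`. [folklore] -/
def sabs (t : ℝ) : ℝ := 1 + ∫ u in (1 : ℝ)..t, oddTrans u

/-- `hasDerivAt_sabs` (hasDerivAt sabs). [folklore] -/
theorem hasDerivAt_sabs (t : ℝ) : HasDerivAt sabs (oddTrans t) t := by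
  unfold sabs
  have h := intervalIntegral.integral_hasDerivAt_right (continuous_oddTrans.intervalIntegrable 1 t)
    (continuous_oddTrans.stronglyMeasurableAtFilter _ _) continuous_oddTrans.continuousAt
  simpa using h.const_add 1

/-- `deriv_sabs` (deriv sabs). [folklore] -/
theorem deriv_sabs : deriv sabs = oddTrans := funext fun t => (hasDerivAt_sabs t).deriv

/-- `differentiable_sabs` (differentiable sabs). [folklore] -/
theorem differentiable_sabs : Differentiable ℝ sabs := fun t => (hasDerivAt_sabs t).differentiableAt

/-- `continuous_sabs` (continuous sabs). [folklore] -/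
theorem continuous_sabs : Continuous sabs := differentiable_sabs.continuous

/-- `contDiff_sabs` (contDiff sabs). [folklore] -/
theorem contDiff_sabs {n : ℕ∞} : ContDiff ℝ n sabs := by
  suffices h : ContDiff ℝ ∞ sabs from h.of_le (by exact_mod_cast le_top)
  rw [contDiff_infty]
  intro n
  cases n with
  | zero => exact contDiff_zero.2 continuous_sabs
  | succ n =>
    push_cast
    rw [contDiff_succ_iff_deriv]
    refine ⟨differentiable_sabs, fun h => absurd h (by simp), ?_⟩
    rw [deriv_sabs]
    exact contDiff_oddTrans

/-- `sabs_one` (sabs one). [folklore] -/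
theorem sabs_one : sabs 1 = 1 := by simp [sabs]

/-- `sabs_of_one_le` (sabs of one le). [folklore] -/
theorem sabs_of_one_le {t : ℝ} (ht : 1 ≤ t) : sabs t = t := by
  unfold sabs
  rw [intervalIntegral.integral_congr (g := fun _ => (1 : ℝ)) (fun u hu => ?_)]
  · simp
  · rw [uIcc_of_le ht] at hu
    exact oddTrans_of_one_le hu.1

/-- `A` is even (`μ` is odd). [folklore] -/
theorem sabs_neg (t : ℝ) : sabs (-t) = sabs t := by
  -- both sides have the same derivative relation: `d/dt [A(-t) - A(t)] = -μ(-t) - μ(t) = 0`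
  have hd : ∀ u, HasDerivAt (fun u => sabs (-u) - sabs u) 0 u := by
    intro u
    have h1 : HasDerivAt (fun u => sabs (-u)) (oddTrans (-u) * (-1)) u :=
      (hasDerivAt_sabs (-u)).comp u (hasDerivAt_neg u)
    have h2 := h1.sub (hasDerivAt_sabs u)
    refine h2.congr_deriv ?_
    rw [oddTrans_neg]; ring
  have hconst := is_const_of_deriv_eq_zero (f := fun u => sabs (-u) - sabs u)
    (fun u => (hd u).differentiableAt) (fun u => (hd u).deriv) t 0
  simp only [neg_zero, sub_self] at hconst
  linarith

/-- `sabs_of_le_neg_one` (sabs of le neg one). [folklore] -/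
theorem sabs_of_le_neg_one {t : ℝ} (ht : t ≤ -1) : sabs t = -t := by
  rw [← sabs_neg, sabs_of_one_le (by linarith)]

/-- `A(t) = |t|` for `|t| ≥ 1`. [folklore] -/
theorem sabs_of_one_le_abs {t : ℝ} (ht : 1 ≤ |t|) : sabs t = |t| := by
  rcases le_or_gt 0 t with h | h
  · rw [abs_of_nonneg h] at ht ⊢; exact sabs_of_one_le ht
  · rw [abs_of_neg h] at ht ⊢; exact sabs_of_le_neg_one (by linarith)

/-- `A(t) - t` is antitone. [folklore] -/
theorem antitone_sabs_sub_id : Antitone fun t => sabs t - t := by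
  refine antitone_of_deriv_nonpos (differentiable_sabs.sub differentiable_id) fun t => ?_
  have hd : HasDerivAt (fun t => sabs t - t) (oddTrans t - 1) t := (hasDerivAt_sabs t).sub (hasDerivAt_id t)
  rw [hd.deriv]
  linarith [oddTrans_le_one t]

/-- `|t| ≤ A(t)`. [folklore] -/
theorem abs_le_sabs (t : ℝ) : |t| ≤ sabs t := by
  have key : ∀ u, u ≤ sabs u := by
    intro u
    rcases le_or_gt u 1 with h | h
    · have := antitone_sabs_sub_id h
      simp only [sabs_one, sub_self] at this
      linarith
    · rw [sabs_of_one_le h.le]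
  rcases le_or_gt 0 t with h | h
  · rw [abs_of_nonneg h]; exact key t
  · rw [abs_of_neg h, ← sabs_neg]; exact key (-t)

/-- `A(t) ≤ |t| + 1`. [folklore] -/
theorem sabs_le_abs_add_one (t : ℝ) : sabs t ≤ |t| + 1 := by
  have h0 : sabs 0 ≤ 1 := by
    -- `A(0) = 1 - ∫₀¹ μ ≤ 1` since `μ ≥ 0` on `[0, 1]`
    unfold sabs
    rw [intervalIntegral.integral_symm]
    have : 0 ≤ ∫ u in (0 : ℝ)..1, oddTrans u :=
      intervalIntegral.integral_nonneg zero_le_one fun u hu => oddTrans_nonneg hu.1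
    linarith
  have key : ∀ u, 0 ≤ u → sabs u ≤ u + 1 := by
    intro u hu
    have := antitone_sabs_sub_id hu
    simp only [sub_zero] at this
    linarith
  rcases le_or_gt 0 t with h | h
  · rw [abs_of_nonneg h]; exact key t h
  · rw [abs_of_neg h, ← sabs_neg]; exact key (-t) (by linarith)

/-- `sabs_nonneg` (sabs nonneg). [folklore] -/
theorem sabs_nonneg (t : ℝ) : 0 ≤ sabs t := (abs_nonneg t).trans (abs_le_sabs t)

/-- The gap `g(t) = A(t) - t μ(t)` (the `σ`-derivative of the perspective `σ A(d/σ)`). [folklore] -/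
def gap (t : ℝ) : ℝ := sabs t - t * oddTrans t

/-- `gap_of_one_le_abs` (gap of one le abs). [folklore] -/
theorem gap_of_one_le_abs {t : ℝ} (ht : 1 ≤ |t|) : gap t = 0 := by
  unfold gap
  rcases le_or_gt 0 t with h | h
  · rw [abs_of_nonneg h] at ht
    rw [sabs_of_one_le ht, oddTrans_of_one_le ht]; ring
  · rw [abs_of_neg h] at ht
    rw [sabs_of_le_neg_one (by linarith), oddTrans_of_le_neg_one (by linarith)]; ring

/-- `gap_neg` (gap neg). [folklore] -/
theorem gap_neg (t : ℝ) : gap (-t) = gap t := by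
  unfold gap; rw [sabs_neg, oddTrans_neg]; ring

/-- `continuous_gap` (continuous gap). [folklore] -/
theorem continuous_gap : Continuous gap := by
  unfold gap; exact continuous_sabs.sub (continuous_id.mul continuous_oddTrans)

/-- `g` is antitone on `[0, ∞)`: its derivative there is `-t μ'(t) ≤ 0`. [folklore] -/
theorem antitoneOn_gap : AntitoneOn gap (Ici 0) := by
  refine antitoneOn_of_deriv_nonpos (convex_Ici 0) continuous_gap.continuousOn ?_ ?_
  · exact (differentiable_sabs.sub (differentiable_id.mul differentiable_oddTrans)).differentiableOn
  · intro x hx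
    rw [interior_Ici] at hx
    have hx' : 0 < x := hx
    have hd : HasDerivAt gap (oddTrans x - (1 * oddTrans x + x * deriv oddTrans x)) x :=
      (hasDerivAt_sabs x).sub ((hasDerivAt_id x).mul (differentiable_oddTrans x).hasDerivAt)
    rw [hd.deriv]
    have := deriv_oddTrans_nonneg x
    nlinarith

/-- **`g ≥ 0`**: `g` is antitone on `[0, ∞)` with `g = 0` on `[1, ∞)`, and even. [folklore] -/
theorem gap_nonneg (t : ℝ) : 0 ≤ gap t := by
  have key : ∀ u, 0 ≤ u → 0 ≤ gap u := by
    intro u hu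
    rcases le_or_gt 1 u with h1 | h1
    · rw [gap_of_one_le_abs (by rwa [abs_of_nonneg hu])]
    · have := antitoneOn_gap (show u ∈ Ici (0 : ℝ) from hu) (show (1 : ℝ) ∈ Ici 0 by norm_num) h1.le
      rwa [gap_of_one_le_abs (by norm_num)] at this
  rcases le_or_gt 0 t with h | h
  · exact key t h
  · rw [← gap_neg]; exact key (-t) (by linarith)

/-- `g ≤ 1`: the maximum of the even function `g`, antitone on `[0, ∞)`, is `g(0) = A(0) ≤ 1`.
[folklore] -/
theorem gap_le_one (t : ℝ) : gap t ≤ 1 := by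
  have h0 : gap 0 ≤ 1 := by
    have := sabs_le_abs_add_one 0
    simp only [gap, abs_zero, zero_add, zero_mul, sub_zero] at this ⊢
    exact this
  have key : ∀ u, 0 ≤ u → gap u ≤ 1 := fun u hu =>
    (antitoneOn_gap (show (0 : ℝ) ∈ Ici 0 by simp) (show u ∈ Ici (0 : ℝ) from hu) hu).trans h0
  rcases le_or_gt 0 t with h | h
  · exact key t h
  · rw [← gap_neg]; exact key (-t) (by linarith)

/-! ### §3 The corner function -/

variable {r2 s : ℝ}

/-- The band width `σ(a, b) = s (2r² - a - b)`. [folklore] -/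
def bandW (r2 s : ℝ) (p : ℝ × ℝ) : ℝ := s * (2 * r2 - p.1 - p.2)

/-- **The corner function** `G(a, b) = (a + b)/2 - σ/2 · A((a - b)/σ)`, `σ = s(2r² - a - b)`: a
symmetric one-homogeneous smoothing of `min(a, b)` near the diagonal, used to round the corners
of the plumbing (Kosinski VI.12 p. 120, VI.6). [cite: Kosinski1993, VI.12 p. 120] -/
def cornerFn (r2 s : ℝ) (p : ℝ × ℝ) : ℝ :=
  (p.1 + p.2) / 2 - bandW r2 s p / 2 * sabs ((p.1 - p.2) / bandW r2 s p)

/-- `bandW_pos` (bandW pos). [folklore] -/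
theorem bandW_pos (hs : 0 < s) {p : ℝ × ℝ} (hp : p.1 + p.2 < 2 * r2) : 0 < bandW r2 s p := by
  unfold bandW; nlinarith

/-- `bandW_swap` (bandW swap). [folklore] -/
theorem bandW_swap (p : ℝ × ℝ) : bandW r2 s p.swap = bandW r2 s p := by
  rw [bandW, bandW, Prod.fst_swap, Prod.snd_swap]; ring

/-- **Symmetry**: `G(b, a) = G(a, b)`. [folklore] -/
theorem cornerFn_swap (p : ℝ × ℝ) : cornerFn r2 s p.swap = cornerFn r2 s p := by
  simp only [cornerFn, bandW_swap, Prod.fst_swap, Prod.snd_swap]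
  rw [show (p.2 - p.1) / bandW r2 s p = -((p.1 - p.2) / bandW r2 s p) by ring, sabs_neg]
  ring

/-- `cornerFn_comm` (cornerFn comm). [folklore] -/
theorem cornerFn_comm (a b : ℝ) : cornerFn r2 s (b, a) = cornerFn r2 s (a, b) :=
  cornerFn_swap (a, b)

/-- **Off the wedge the corner function is the minimum**: if `|a - b| ≥ σ` then
`G(a, b) = min(a, b)`. [folklore] -/
theorem cornerFn_eq_min (hs : 0 < s) {p : ℝ × ℝ} (hp : p.1 + p.2 < 2 * r2)
    (h : bandW r2 s p ≤ |p.1 - p.2|) : cornerFn r2 s p = min p.1 p.2 := by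
  have hσ := bandW_pos hs hp
  have h1 : bandW r2 s p / 2 * sabs ((p.1 - p.2) / bandW r2 s p) = |p.1 - p.2| / 2 := by
    rw [sabs_of_one_le_abs (by rw [abs_div, abs_of_pos hσ, le_div_iff₀ hσ, one_mul]; exact h),
      abs_div, abs_of_pos hσ]
    field_simp
  unfold cornerFn
  rw [h1, min_def]
  split_ifs with hab
  · rw [abs_of_nonpos (by linarith)]; ring
  · rw [abs_of_pos (by linarith)]; ring

/-- **Bounds**: `min(a, b) - σ/2 ≤ G(a, b) ≤ min(a, b)`. [folklore] -/
theorem cornerFn_le_min (hs : 0 < s) {p : ℝ × ℝ} (hp : p.1 + p.2 < 2 * r2) :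
    cornerFn r2 s p ≤ min p.1 p.2 := by
  have hσ := bandW_pos hs hp
  have h1 := abs_le_sabs ((p.1 - p.2) / bandW r2 s p)
  rw [abs_div, abs_of_pos hσ, div_le_iff₀ hσ] at h1
  unfold cornerFn
  rw [min_def]
  split_ifs with hab
  · rw [abs_of_nonpos (by linarith)] at h1; nlinarith
  · rw [abs_of_pos (by linarith)] at h1; nlinarith

/-- `min_sub_le_cornerFn` (min sub le cornerFn). [folklore] -/
theorem min_sub_le_cornerFn (hs : 0 < s) {p : ℝ × ℝ} (hp : p.1 + p.2 < 2 * r2) :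
    min p.1 p.2 - bandW r2 s p / 2 ≤ cornerFn r2 s p := by
  have hσ := bandW_pos hs hp
  have h1 := sabs_le_abs_add_one ((p.1 - p.2) / bandW r2 s p)
  rw [abs_div, abs_of_pos hσ] at h1
  have h2 : bandW r2 s p * sabs ((p.1 - p.2) / bandW r2 s p) ≤ |p.1 - p.2| + bandW r2 s p := by
    have := mul_le_mul_of_nonneg_left h1 hσ.le
    rwa [mul_add, mul_div_cancel₀ _ hσ.ne', mul_one] at this
  unfold cornerFn
  rw [min_def]
  split_ifs with hab
  · rw [abs_of_nonpos (by linarith)] at h2; nlinarith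
  · rw [abs_of_pos (by linarith)] at h2; nlinarith

/-- `G(a, b) ≤ 0` when `min(a, b) ≤ 0`; in particular on the axes. [folklore] -/
theorem cornerFn_nonpos (hs : 0 < s) {p : ℝ × ℝ} (hp : p.1 + p.2 < 2 * r2) (h : min p.1 p.2 ≤ 0) :
    cornerFn r2 s p ≤ 0 := (cornerFn_le_min hs hp).trans h

/-- **Smoothness** on the half plane `{a + b < 2r²}`. [folklore] -/
theorem contDiffAt_cornerFn {n : ℕ∞} (hs : 0 < s) {p : ℝ × ℝ} (hp : p.1 + p.2 < 2 * r2) :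
    ContDiffAt ℝ n (cornerFn r2 s) p := by
  have hσ := bandW_pos hs hp
  have hband : ContDiffAt ℝ n (bandW r2 s) p := by
    unfold bandW; fun_prop
  unfold cornerFn
  refine ((contDiffAt_fst.add contDiffAt_snd).div_const 2).sub ?_
  refine (hband.div_const 2).mul (contDiff_sabs.contDiffAt.comp p ?_)
  exact (contDiffAt_fst.sub contDiffAt_snd).div hband hσ.ne'

/-- `contDiffOn_cornerFn` (contDiffOn cornerFn). [folklore] -/
theorem contDiffOn_cornerFn {n : ℕ∞} (hs : 0 < s) :
    ContDiffOn ℝ n (cornerFn r2 s) {p | p.1 + p.2 < 2 * r2} := fun _ hp =>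
  (contDiffAt_cornerFn hs hp).contDiffWithinAt

/-- `continuousOn_cornerFn` (continuousOn cornerFn). [folklore] -/
theorem continuousOn_cornerFn (hs : 0 < s) :
    ContinuousOn (cornerFn r2 s) {p | p.1 + p.2 < 2 * r2} :=
  (contDiffOn_cornerFn (n := 0) hs).continuousOn

/-! ### §4 Derivatives along the fibre direction and along the diagonal direction -/

/-- The ratio `t = (a - b)/σ`. [folklore] -/
def ratio (r2 s : ℝ) (p : ℝ × ℝ) : ℝ := (p.1 - p.2) / bandW r2 s p

/-- **The fibre slope** `G_b = ½ + ½ μ(t) + (s/2) g(t)` (derivative of `τ ↦ G(a, τ)`). [folklore] -/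
def slopeB (r2 s : ℝ) (p : ℝ × ℝ) : ℝ :=
  1 / 2 + oddTrans (ratio r2 s p) / 2 + s / 2 * gap (ratio r2 s p)

/-- **The base slope** `G_a = ½ - ½ μ(t) + (s/2) g(t)` (derivative of `τ ↦ G(τ, b)`). [folklore] -/
def slopeA (r2 s : ℝ) (p : ℝ × ℝ) : ℝ :=
  1 / 2 - oddTrans (ratio r2 s p) / 2 + s / 2 * gap (ratio r2 s p)

/-- `slopeB_nonneg` (slopeB nonneg). [folklore] -/
theorem slopeB_nonneg (hs : 0 < s) (p : ℝ × ℝ) : 0 ≤ slopeB r2 s p := by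
  unfold slopeB
  have h1 := neg_one_le_oddTrans (ratio r2 s p)
  have h2 := gap_nonneg (ratio r2 s p)
  nlinarith

/-- `slopeA_nonneg` (slopeA nonneg). [folklore] -/
theorem slopeA_nonneg (hs : 0 < s) (p : ℝ × ℝ) : 0 ≤ slopeA r2 s p := by
  unfold slopeA
  have h1 := oddTrans_le_one (ratio r2 s p)
  have h2 := gap_nonneg (ratio r2 s p)
  nlinarith

/-- `G_a + G_b = 1 + s g(t) ≥ 1`. [folklore] -/
theorem slopeA_add_slopeB (p : ℝ × ℝ) : slopeA r2 s p + slopeB r2 s p = 1 + s * gap (ratio r2 s p) := by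
  unfold slopeA slopeB; ring

/-- `one_le_slopeA_add_slopeB` (one le slopeA add slopeB). [folklore] -/
theorem one_le_slopeA_add_slopeB (hs : 0 < s) (p : ℝ × ℝ) : 1 ≤ slopeA r2 s p + slopeB r2 s p := by
  rw [slopeA_add_slopeB]; nlinarith [gap_nonneg (ratio r2 s p)]

/-- `slopeB_le` (slopeB le). [folklore] -/
theorem slopeB_le (hs : 0 < s) (p : ℝ × ℝ) : slopeB r2 s p ≤ 1 + s := by
  unfold slopeB
  have h1 := oddTrans_le_one (ratio r2 s p)
  have h2 := gap_le_one (ratio r2 s p)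
  nlinarith

/-- `slopeA_le` (slopeA le). [folklore] -/
theorem slopeA_le (hs : 0 < s) (p : ℝ × ℝ) : slopeA r2 s p ≤ 1 + s := by
  unfold slopeA
  have h1 := neg_one_le_oddTrans (ratio r2 s p)
  have h2 := gap_le_one (ratio r2 s p)
  nlinarith

/-- The slopes are swapped under `(a, b) ↦ (b, a)`. [folklore] -/
theorem slopeA_swap (p : ℝ × ℝ) : slopeA r2 s p.swap = slopeB r2 s p := by
  simp only [slopeA, slopeB, ratio, bandW_swap, Prod.fst_swap, Prod.snd_swap]
  rw [show (p.2 - p.1) / bandW r2 s p = -((p.1 - p.2) / bandW r2 s p) by ring, oddTrans_neg, gap_neg]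
  ring

/-- **Derivative along the fibre direction**: `d/dτ G(a, τ) = G_b(a, τ)`. [folklore] -/
theorem hasDerivAt_cornerFn_snd (hs : 0 < s) {a b : ℝ} (hab : a + b < 2 * r2) :
    HasDerivAt (fun τ => cornerFn r2 s (a, τ)) (slopeB r2 s (a, b)) b := by
  have hσ : 0 < bandW r2 s (a, b) := bandW_pos hs hab
  -- `σ(τ) = s (2 r2 - a - τ)`, `σ' = -s`
  have hσd : HasDerivAt (fun τ => bandW r2 s (a, τ)) (-s) b := by
    have : (fun τ => bandW r2 s (a, τ)) = fun τ => s * (2 * r2 - a) + (-s) * τ := by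
      funext τ; simp only [bandW]; ring
    rw [this]
    simpa using ((hasDerivAt_id b).const_mul (-s)).const_add (s * (2 * r2 - a))
  -- `d(τ) = a - τ`, `d' = -1`
  have hdd : HasDerivAt (fun τ => a - τ) (-1) b := by simpa using (hasDerivAt_id b).const_sub a
  -- `t(τ) = d/σ`
  have ht : HasDerivAt (fun τ => (a - τ) / bandW r2 s (a, τ))
      (((-1) * bandW r2 s (a, b) - (a - b) * (-s)) / bandW r2 s (a, b) ^ 2) b := hdd.div hσd hσ.ne'
  -- `A ∘ t`
  have hA := (hasDerivAt_sabs ((a - b) / bandW r2 s (a, b))).comp b ht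
  -- the product `σ/2 * A(t)`
  have hprod := (hσd.div_const 2).mul hA
  -- the sum `(a + τ)/2`
  have hlin : HasDerivAt (fun τ => (a + τ) / 2) (1 / 2) b := by
    simpa using ((hasDerivAt_id b).const_add a).div_const 2
  have hall := hlin.sub hprod
  have heq : (fun τ => cornerFn r2 s (a, τ)) =
      fun τ => (a + τ) / 2 - bandW r2 s (a, τ) / 2 * sabs ((a - τ) / bandW r2 s (a, τ)) := by
    funext τ; rfl
  rw [heq]
  refine hall.congr_deriv ?_
  have key : ∀ σ A μ : ℝ, σ ≠ 0 →
      1 / 2 - (-s / 2 * A + σ / 2 * (μ * ((-1 * σ - (a - b) * -s) / σ ^ 2))) =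
        1 / 2 + μ / 2 + s / 2 * (A - (a - b) / σ * μ) := by
    intro σ A μ hσ0
    field_simp
    ring
  have hs' : slopeB r2 s (a, b) = 1 / 2 + oddTrans ((a - b) / bandW r2 s (a, b)) / 2 +
      s / 2 * (sabs ((a - b) / bandW r2 s (a, b)) -
        (a - b) / bandW r2 s (a, b) * oddTrans ((a - b) / bandW r2 s (a, b))) := rfl
  rw [hs']
  simp only [Function.comp_apply]
  exact key _ _ _ hσ.ne'

/-- **Derivative along the base direction**: `d/dτ G(τ, b) = G_a(τ, b)` (by symmetry). [folklore] -/
theorem hasDerivAt_cornerFn_fst (hs : 0 < s) {a b : ℝ} (hab : a + b < 2 * r2) :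
    HasDerivAt (fun τ => cornerFn r2 s (τ, b)) (slopeA r2 s (a, b)) a := by
  have h := hasDerivAt_cornerFn_snd (r2 := r2) hs (a := b) (b := a) (by linarith)
  have heq : (fun τ => cornerFn r2 s (τ, b)) = fun τ => cornerFn r2 s (b, τ) := by
    funext τ; exact (cornerFn_comm τ b).symm
  have hsw : slopeA r2 s (a, b) = slopeB r2 s (b, a) := slopeA_swap (r2 := r2) (s := s) (b, a)
  rw [heq, hsw]
  exact h

/-- **Derivative along the diagonal direction**: `d/dτ G(a + τ, b + τ) = 1 + s g(t) ≥ 1`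
(`t` the ratio at `(a + τ, b + τ)`). [folklore] -/
theorem hasDerivAt_cornerFn_diag (hs : 0 < s) {a b τ₀ : ℝ} (hab : a + b + 2 * τ₀ < 2 * r2) :
    HasDerivAt (fun τ => cornerFn r2 s (a + τ, b + τ)) (1 + s * gap (ratio r2 s (a + τ₀, b + τ₀))) τ₀ := by
  have hσ : 0 < bandW r2 s (a + τ₀, b + τ₀) := bandW_pos hs (by simp only; linarith)
  -- along the diagonal `d = a - b` is constant and `σ(τ) = s (2 r2 - a - b) - 2 s τ`
  have hσd : HasDerivAt (fun τ => bandW r2 s (a + τ, b + τ)) (-(2 * s)) τ₀ := by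
    have : (fun τ => bandW r2 s (a + τ, b + τ)) = fun τ => s * (2 * r2 - a - b) + (-(2 * s)) * τ := by
      funext τ; simp only [bandW]; ring
    rw [this]
    simpa using ((hasDerivAt_id τ₀).const_mul (-(2 * s))).const_add (s * (2 * r2 - a - b))
  have ht : HasDerivAt (fun τ => (a - b) / bandW r2 s (a + τ, b + τ))
      ((0 * bandW r2 s (a + τ₀, b + τ₀) - (a - b) * (-(2 * s))) / bandW r2 s (a + τ₀, b + τ₀) ^ 2) τ₀ :=
    (hasDerivAt_const τ₀ (a - b)).div hσd hσ.ne'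
  have hA : HasDerivAt (fun τ => sabs ((a - b) / bandW r2 s (a + τ, b + τ)))
      (oddTrans ((a - b) / bandW r2 s (a + τ₀, b + τ₀)) *
        ((0 * bandW r2 s (a + τ₀, b + τ₀) - (a - b) * (-(2 * s))) / bandW r2 s (a + τ₀, b + τ₀) ^ 2)) τ₀ :=
    (hasDerivAt_sabs _).comp τ₀ ht
  have hprod := (hσd.div_const 2).mul hA
  have hlin : HasDerivAt (fun τ => (a + τ + (b + τ)) / 2) 1 τ₀ := by
    have : (fun τ : ℝ => (a + τ + (b + τ)) / 2) = fun τ => (a + b) / 2 + 1 * τ := by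
      funext τ; ring
    rw [this]
    simpa using ((hasDerivAt_id τ₀).const_mul (1 : ℝ)).const_add ((a + b) / 2)
  have hall := hlin.sub hprod
  have heq : (fun τ => cornerFn r2 s (a + τ, b + τ)) = fun τ => (a + τ + (b + τ)) / 2 -
      bandW r2 s (a + τ, b + τ) / 2 * sabs ((a - b) / bandW r2 s (a + τ, b + τ)) := by
    funext τ
    simp only [cornerFn]
    congr 2
    · congr 2; ring
  rw [heq]
  refine hall.congr_deriv ?_
  simp only [ratio, gap, bandW]
  field_simp
  ring

/-- Positive levels of the corner function miss the axes: `G(a, b) > 0 ⇒ a > 0 ∧ b > 0`.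
[folklore] -/
theorem pos_of_cornerFn_pos (hs : 0 < s) {p : ℝ × ℝ} (hp : p.1 + p.2 < 2 * r2)
    (h : 0 < cornerFn r2 s p) : 0 < p.1 ∧ 0 < p.2 := by
  have := lt_of_lt_of_le h (cornerFn_le_min hs hp)
  exact ⟨lt_of_lt_of_le this (min_le_left _ _), lt_of_lt_of_le this (min_le_right _ _)⟩

/-- **Monotonicity in the fibre variable**: `b ≤ b' ⇒ G(a, b) ≤ G(a, b')` (on `a + b' < 2r²`).
[folklore] -/
theorem cornerFn_mono_snd (hs : 0 < s) {a b b' : ℝ} (hbb' : b ≤ b') (hab' : a + b' < 2 * r2) :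
    cornerFn r2 s (a, b) ≤ cornerFn r2 s (a, b') := by
  have hmono : MonotoneOn (fun τ => cornerFn r2 s (a, τ)) (Iio (2 * r2 - a)) := by
    refine monotoneOn_of_deriv_nonneg (convex_Iio _) ?_ ?_ ?_
    · intro τ hτ
      have hτ' : a + τ < 2 * r2 := by have := mem_Iio.1 hτ; linarith
      exact (hasDerivAt_cornerFn_snd hs hτ').continuousAt.continuousWithinAt
    · intro τ hτ
      rw [interior_Iio] at hτ
      have hτ' : a + τ < 2 * r2 := by have := mem_Iio.1 hτ; linarith
      exact (hasDerivAt_cornerFn_snd hs hτ').differentiableAt.differentiableWithinAt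
    · intro τ hτ
      rw [interior_Iio] at hτ
      have hτ' : a + τ < 2 * r2 := by have := mem_Iio.1 hτ; linarith
      rw [(hasDerivAt_cornerFn_snd hs hτ').deriv]
      exact slopeB_nonneg hs _
  exact hmono (show b ∈ Iio (2 * r2 - a) by rw [mem_Iio]; linarith)
    (show b' ∈ Iio (2 * r2 - a) by rw [mem_Iio]; linarith) hbb'

/-- **Monotonicity in the base variable**: `a ≤ a' ⇒ G(a, b) ≤ G(a', b)` (on `a' + b < 2r²`).
[folklore] -/
theorem cornerFn_mono_fst (hs : 0 < s) {a a' b : ℝ} (haa' : a ≤ a') (hab' : a' + b < 2 * r2) :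
    cornerFn r2 s (a, b) ≤ cornerFn r2 s (a', b) := by
  rw [← cornerFn_comm a b, ← cornerFn_comm a' b]
  exact cornerFn_mono_snd hs haa' (by linarith)

/-- **Strict increase along the diagonal direction**: `τ ↦ G(a + τ, b + τ)` is strictly
increasing (slope `≥ 1`) on `{a + b + 2τ < 2r²}`; quantitatively
`G(a + τ, b + τ) ≥ G(a, b) + τ` for `τ ≥ 0`. [folklore] -/
theorem cornerFn_add_le_cornerFn_diag (hs : 0 < s) {a b τ : ℝ} (hτ : 0 ≤ τ)
    (h : a + b + 2 * τ < 2 * r2) : cornerFn r2 s (a, b) + τ ≤ cornerFn r2 s (a + τ, b + τ) := by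
  -- the function `u ↦ G(a + u, b + u) - u` is monotone on `(-∞, T)`, `T = r2 - (a + b)/2`
  set T := r2 - (a + b) / 2 with hT
  have hderiv : ∀ u, u < T → HasDerivAt (fun u => cornerFn r2 s (a + u, b + u) - u)
      (1 + s * gap (ratio r2 s (a + u, b + u)) - 1) u := by
    intro u hu
    have hu' : a + b + 2 * u < 2 * r2 := by rw [hT] at hu; linarith
    exact (hasDerivAt_cornerFn_diag (r2 := r2) hs hu').sub (hasDerivAt_id u)
  have hmono : MonotoneOn (fun u => cornerFn r2 s (a + u, b + u) - u) (Iio T) := by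
    refine monotoneOn_of_deriv_nonneg (convex_Iio _) ?_ ?_ ?_
    · intro u hu; exact (hderiv u hu).continuousAt.continuousWithinAt
    · intro u hu; rw [interior_Iio] at hu; exact (hderiv u hu).differentiableAt.differentiableWithinAt
    · intro u hu
      rw [interior_Iio] at hu
      rw [(hderiv u hu).deriv]
      nlinarith [gap_nonneg (ratio r2 s (a + u, b + u))]
  have h0 : (0 : ℝ) ∈ Iio T := by rw [mem_Iio, hT]; linarith
  have h1 : τ ∈ Iio T := by rw [mem_Iio, hT]; linarith
  have := hmono h0 h1 hτ
  simp only [add_zero, sub_zero] at this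
  linarith

end Plumbing

end Literature.Topology.FourManifolds
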